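import Summits.AtomisticToContinuum.Crystallization.Theorems.ChargedEnergyGapFibreChargeA
import HarnessLib

/-!
# ChargedEnergyGap · NODE 83 «FibreCharge» (lens-3 g82) — file B of four: THE ONE-FIBRE STATEMENT (F) `FibreChargeQ`, its low-column part (F_lo)
`FibreChargeLowQ` [TABLE · ONE-DIMENSIONAL], and (F) ⟸ (F_lo) PROVED (key columns `11–12` carry no second marked hole)

Line of record `stmt-AtomisticToContinuum-14231` (`Summit.AtomisticToContinuum.ChargedEnergyGap`), route PricedLinkCensus; NODE 83 sits beneath NODE 82
«LineMoment» (tree `…Theorems.ChargedEnergyGapLineMomentA|B|∅`, cone of record `chargedEnergyGap_of_lineMoment_numerics`, 35 hypotheses).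

THIS FILE.  §B1: one axis line of the cubic frame read as a SEQUENCE — depths `e : ℤ → ℝ` (`≥ 0`, `ρ`-Lipschitz, discretely semiconcave `e(t+1)² + e(t−1)²
≤ 2e(t)² + 2ρ²`), hole min-depths `m` in the window `[e(t) − ρ, min(e(t−1), e(t+1))]`, a finite marked set `S` of holes (pairwise EVEN offsets, span `≤
2(R_N + ρ)/ρ`, table-admissible: row `≥ 1`, kink column `≥ 2`, min-depth `< 140`) and its key `t₀` (largest kink `kink1`, nearest-first):
`IsMarkedFibre`; (F) `FibreChargeQ R_N ρlo ρhi`: `Σ_S capK ≤ capK(key) + lineExcess(col key, |S|)`; (F_lo) `FibreChargeLowQ` = (F) restricted to key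
columns `≤ 10` — THE NEW TABLE LEAF (a one-dimensional SUFFICIENT condition for (LB): one line, no frame, no lattice, no marking predicate, the
off-line pole depths relaxed to the min-depth window; the object of census-1's interval line DP).  §B2 ★★ `fc_noSecondHole_core`
(PROVED, the discrete impact-parameter argument): after a key of kink `≥ 1.9` at depth `e₀ < 140 + ρ` with a neighbour `≥ 93.5`, the squared-depth
increments `δ_j = e(j+1)² − e(j)²` start at `δ₀ ≤ −0.9ρ(e₀ + e₁) ≤ −2ρ²` and grow by `≤ 2ρ²` per step; while `δ ≤ −2ρ²` the quantity `4ρ² e² − δ²`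
decreases by `≥ 4ρ⁴` per step (DESCENT, `fc_descent`), afterwards `e²` grows at most like an arithmetic series (ASCENT, `fc_ascent`); within the window
`n ρ ≤ 2(80 + ρ)` a second hole with kink `≥ 1` and a neighbour `≥ 93.5` is impossible (endgame: a quadratic in `e₀ ∈ [94, 141]` with values `≤ −4477`).
`fc_eq_key_of_kink`: hence a key of column `≥ 11` is the ONLY marked hole of its fibre (translation / reflection to the core; parity ⇒ gap `≥ 2`).  §B3 ★★
`fibreChargeQ_of_low` : (F_lo) → (F) at `(80, 0.679, 0.691)` (columns `≥ 11`: the sum is the key's own charge, `lineExcess ≥ 0`).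

Imports ONLY `…ChargedEnergyGapFibreChargeA` and `HarnessLib`; no `set_option`, no `sorry`, no instance, no notation, no `private`; all arithmetic closers
are `linarith only` / `nlinarith only` with explicit certificates (large contexts).
-/

noncomputable section

open scoped Classical
open Literature.MathematicalPhysics.StatisticalMechanics Literature.Geometry.DiscreteGeometry
open Summit.AtomisticToContinuum.Crystallization.Theses.PricedLinkCensus
open Summit.AtomisticToContinuum.Crystallization.Theorems.ChargedEnergyGapNegative

namespace Summit.AtomisticToContinuum.Crystallization.Theorems.ChargedEnergyGapChartDial

/-! ## §B1 The one-fibre statement (F) `FibreChargeQ` and its low-column part (F_lo) `FibreChargeLowQ` -/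

section Fibre

/-- ★ The ONE-DIMENSIONAL KINK of a depth sequence `e : ℤ → ℝ` (lattice spacing `ρ`) at `t`: `(2 e(t) − e(t+1) − e(t−1))/ρ` — the axial kink
`hKink` of the hole `k + t e_a` read along its own line. -/
def kink1 (ρ : ℝ) (e : ℤ → ℝ) (t : ℤ) : ℝ :=
  (2 * e t - e (t + 1) - e (t - 1)) / ρ

/-- ★ A MARKED FIBRE `(e, m, S, t₀)` at spacing `ρ` and radius `R_N` — the data of ONE axis line of (LB) `LineChargeQ`: a depth sequence
`e : ℤ → ℝ≥0` obeying the two line constraints of a distance function sampled at spacing `ρ` (`1`-Lipschitz steps, discrete semiconcavity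
`e(t+1)² + e(t−1)² ≤ 2e(t)² + 2ρ²`), a MIN-DEPTH RELAXATION `m` (`e(t) − ρ ≤ m(t) ≤ min(e(t−1), e(t+1))`: the true hole min-depth over the six
vertices lies in this window), a finite set `S` of MARKED positions — pairwise at even lattice distance (holes of one parity class) and within
`2(R_N + ρ)` of each other (two holes within `R_N + ρ` of a common centre), each in the charged part of the table (row `≥ 1`, kink column `≥ 2`,
min-depth `< 140`) — and the KEY `t₀ ∈ S`: lexicographically largest `(kink, −position)`. -/
def IsMarkedFibre (R_N ρ : ℝ) (e m : ℤ → ℝ) (S : Finset ℤ) (t₀ : ℤ) : Prop :=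
  (∀ t, 0 ≤ e t) ∧ (∀ t, |e (t + 1) - e t| ≤ ρ) ∧ (∀ t, e (t + 1) ^ 2 + e (t - 1) ^ 2 ≤ 2 * e t ^ 2 + 2 * ρ ^ 2) ∧
    (∀ t, e t - ρ ≤ m t ∧ m t ≤ e (t - 1) ∧ m t ≤ e (t + 1)) ∧
    (∀ t ∈ S, ∀ t' ∈ S, Even (t - t') ∧ |((t : ℝ) - t')| * ρ ≤ 2 * (R_N + ρ)) ∧
    (∀ t ∈ S, 1 ≤ capKRow (m t) ∧ 2 ≤ capKCol (kink1 ρ e t) ∧ m t < 140) ∧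
    t₀ ∈ S ∧ (∀ t ∈ S, kink1 ρ e t < kink1 ρ e t₀ ∨ (kink1 ρ e t = kink1 ρ e t₀ ∧ t₀ ≤ t))

/-- ★★★ **(F) THE ONE-FIBRE CHARGE INEQUALITY** (one-dimensional, finite): for every spacing `ρ ∈ [ρlo, ρhi]` and every marked fibre
`(e, m, S, t₀)` the total table charge of the marked positions is at most the key's charge plus the line excess of the key's column and the count:
`Σ_{t ∈ S} capK(m t, kink1 t) ≤ capK(m t₀, kink1 t₀) + E(col(kink1 t₀), |S|)` — equivalently (the key's own term cancels) the NON-KEY marked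
positions carry at most `E` in total.  This is EXACTLY the optimal-control problem of NODE 82's line DP `num/zkey.py` (state `(depth, slope)`,
window `2(R_N + ρ)`, marked holes at even offsets, rows from the min-depth window, charged kinks `≤` the key's): (LB) ⟸ (F) is PROVED below
(`lineChargeQ_of_fibre`: finiteness of the marked set, partition into line fibres, one key per fibre, the fibre read as a sequence).
[TABLE · 1D · the conjunction (F) = (F_lo) ∧ (F_hi) with (F_hi) PROVED (`fibreChargeQ_of_low`)] -/
def FibreChargeQ (R_N ρlo ρhi : ℝ) : Prop :=
  ∀ ρ : ℝ, ρlo ≤ ρ → ρ ≤ ρhi → ∀ (e m : ℤ → ℝ) (S : Finset ℤ) (t₀ : ℤ), IsMarkedFibre R_N ρ e m S t₀ →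
    ∑ t ∈ S, capK (m t) (kink1 ρ e t) ≤ capK (m t₀) (kink1 ρ e t₀) + lineExcess (capKCol (kink1 ρ e t₀)) S.card

/-- ★★★ **(F_lo) THE ONE-FIBRE CHARGE INEQUALITY FOR KEY COLUMNS `≤ 10`** (`kink1 t₀ < 1.9`) — the residual TABLE leaf of NODE 83: (F) restricted
to keys of kink column `2 … 10`, where the line-excess table is positive (`2.6 … 44.3 c_T`) and was produced by the grid DP of NODE 82 with margin
`×1.05 + 0.3`.  [TABLE · 1D optimal control over `≤ 120` lattice steps with a `2`-dimensional state · NEW as typed · TRUE-leaning (DP census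
`RESULTS-g81.md` §B) · INSTRUMENTABLE (census-1: the same DP in exact rational interval arithmetic with outward rounding = a certificate) ·
ATTACKABLE-M (kink budget: `Σ_t kink1(t) ρ` telescopes to a slope difference `≤ 2ρ` plus the semiconcavity defects `≤ ρ²/e ≤ 0.0051ρ` per step, so at
most THREE charged positions fit in the window; then a two-hole comparison with the single-point extremal profile per column) — why it might fail:
a depth profile steering through the table's peak rows between two charged kinks more profitably than the DP's `0.05`-grid of free kinks found (a few
`%`, inside the margin), i.e. only by a grid artefact of NODE 82's table, which an interval re-run exposes cell by cell] -/
def FibreChargeLowQ (R_N ρlo ρhi : ℝ) : Prop :=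
  ∀ ρ : ℝ, ρlo ≤ ρ → ρ ≤ ρhi → ∀ (e m : ℤ → ℝ) (S : Finset ℤ) (t₀ : ℤ), IsMarkedFibre R_N ρ e m S t₀ →
    capKCol (kink1 ρ e t₀) ≤ 10 →
    ∑ t ∈ S, capK (m t) (kink1 ρ e t) ≤ capK (m t₀) (kink1 ρ e t₀) + lineExcess (capKCol (kink1 ρ e t₀)) S.card

end Fibre

/-! ## §B2 No second marked hole after a key of column `≥ 11` (PROVED: the discrete impact-parameter argument) -/

section NoSecondHole

/-- Iterated step bound: `δ(j+1) ≤ δ(j) + c` for all `j` gives `δ(j+i) ≤ δ(j) + c i`. [formal bookkeeping] -/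
theorem fc_iter_le (δ : ℕ → ℝ) (c : ℝ) (h : ∀ j, δ (j + 1) ≤ δ j + c) (j i : ℕ) : δ (j + i) ≤ δ j + c * i := by
  induction i with
  | zero => simp
  | succ i ih =>
    have h1 := h (j + i)
    rw [← add_assoc]
    push_cast
    linarith

/-- ★ THE DESCENT INVARIANT (discrete impact parameter): for a sequence of squared depths `D` with second differences `≤ 2r` (`r = ρ²`), as long
as the increments stay `≤ −2r` the quantity `4 r D_j − δ_j²` DROPS by at least `4 r²` per step — the lattice analogue of the conservation of
`d² − (d d′)²` (squared distance of the foot point from the line) along the single-point extremal `d(s)² = d₀² + 2 s d₀ u + s²`, turned into a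
one-sided inequality by semiconcavity. -/
theorem fc_descent (D : ℕ → ℝ) (r : ℝ) (h : ∀ j, D (j + 2) - D (j + 1) ≤ (D (j + 1) - D j) + 2 * r) :
    ∀ J : ℕ, (∀ j, j < J → D (j + 1) - D j ≤ -(2 * r)) →
      4 * r * D J - (D (J + 1) - D J) ^ 2 ≤ 4 * r * D 0 - (D 1 - D 0) ^ 2 - 4 * r ^ 2 * J := by
  intro J
  induction J with
  | zero => intro _; simp
  | succ J ih =>
    intro hJ
    have ih' := ih (fun j hj => hJ j (Nat.lt_succ_of_lt hj))
    have ha : D (J + 1) - D J ≤ -(2 * r) := hJ J (Nat.lt_succ_self J)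
    have hb : D (J + 2) - D (J + 1) ≤ (D (J + 1) - D J) + 2 * r := h J
    have hsq : (D (J + 1) - D J + 2 * r) ^ 2 ≤ (D (J + 2) - D (J + 1)) ^ 2 := by
      nlinarith [mul_nonneg_of_nonpos_of_nonpos (sub_nonpos.2 hb) (by linarith : D (J + 2) - D (J + 1) + (D (J + 1) - D J + 2 * r) ≤ 0)]
    have e2 : J + 1 + 1 = J + 2 := rfl
    rw [e2]
    push_cast
    nlinarith [ih', hsq]

/-- The ASCENT BOUND: increments `δ(J+i) ≤ 2 r i` give `D(J+i) ≤ D(J) + r i²` (an arithmetic series). [formal bookkeeping] -/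
theorem fc_ascent (D : ℕ → ℝ) {r : ℝ} (hr : 0 ≤ r) (J : ℕ) (h : ∀ i : ℕ, D (J + i + 1) - D (J + i) ≤ 2 * r * i) (i : ℕ) :
    D (J + i) ≤ D J + r * (i : ℝ) ^ 2 := by
  induction i with
  | zero => simp
  | succ i ih =>
    have h1 := h i
    rw [← add_assoc]
    push_cast
    nlinarith [ih, h1]

/-- ★★ **NO SECOND HOLE, normalised core** (key at `0`, second marked position at `n ≥ 2`; `ρ ∈ [0.679, 0.691]`, `R_N = 80`): a depth sequence with
`1`-Lipschitz steps and discrete semiconcavity cannot have a kink `≥ 1.9` at `0` with `e(1) ≥ 93.5`, `e(0) < 140 + ρ` AND a kink `≥ 1` at `n` with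
`e(n−1) ≥ 93.5` within `n ρ ≤ 2(80 + ρ)`.  Proof: squared depths `D_j = e(j)²`, increments `δ_j`; `δ_{j+1} ≤ δ_j + 2ρ²`; `δ_0 ≤ −0.9ρ(e₀ + e₁)`;
the second kink forces `δ_{n−1} ≥ 0`; at the first index `J` with `δ_J > −2ρ²` the descent invariant gives `4ρ² D_J ≤ 4ρ² e₀² − δ_0² − 4ρ⁴(J − 1)`,
the ascent bound gives `D_{n−1} ≤ D_J + ρ²(n−1−J)²`, and `2ρ²(J+1) > −δ_0`; with `(n−1)ρ ≤ 160 + ρ` and `D_{n−1} ≥ 93.5²` this is a quadratic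
inequality in `e₀ ∈ [94, 141]` with no solution (margin `≥ 1100` in units of depth²). -/
theorem fc_noSecondHole_core {ρ : ℝ} (hρ₁ : 679 / 1000 ≤ ρ) (hρ₂ : ρ ≤ 691 / 1000) (e : ℤ → ℝ) (n : ℕ) (hn : 2 ≤ n)
    (he : ∀ t, 0 ≤ e t) (hlip : ∀ t, |e (t + 1) - e t| ≤ ρ)
    (hsc : ∀ t, e (t + 1) ^ 2 + e (t - 1) ^ 2 ≤ 2 * e t ^ 2 + 2 * ρ ^ 2)
    (hk0 : 19 / 10 ≤ (2 * e 0 - e 1 - e (-1)) / ρ) (hE : 187 / 2 ≤ e 1) (hup : e 0 < 140 + ρ)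
    (hkn : 1 ≤ (2 * e n - e (n + 1) - e (n - 1)) / ρ) (hEn : 187 / 2 ≤ e ((n : ℤ) - 1))
    (hwin : (n : ℝ) * ρ ≤ 2 * (80 + ρ)) : False := by
  have hρ : 0 < ρ := by linarith
  obtain ⟨k, rfl⟩ : ∃ k, n = k + 2 := ⟨n - 2, by omega⟩
  -- the squared depths along the line, counted from the key
  set D : ℕ → ℝ := fun j => e (j : ℤ) ^ 2 with hD
  have hstep : ∀ j : ℕ, D (j + 2) - D (j + 1) ≤ (D (j + 1) - D j) + 2 * ρ ^ 2 := by
    intro j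
    have h1 := hsc ((j : ℤ) + 1)
    have e1 : (j : ℤ) + 1 + 1 = ((j + 2 : ℕ) : ℤ) := by push_cast; ring
    have e2 : (j : ℤ) + 1 - 1 = ((j : ℕ) : ℤ) := by ring
    have e3 : (j : ℤ) + 1 = ((j + 1 : ℕ) : ℤ) := by push_cast; ring
    rw [e1, e2, e3] at h1
    simp only [hD]
    linarith
  have hstep' : ∀ j : ℕ, (D (j + 1 + 1) - D (j + 1)) ≤ (D (j + 1) - D j) + 2 * ρ ^ 2 := fun j => hstep j
  have hD0 : D 0 = e 0 ^ 2 := by simp [hD]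
  have hD1 : D 1 = e 1 ^ 2 := by simp [hD]
  have hDk1 : D (k + 1) = e ((k + 1 : ℕ) : ℤ) ^ 2 := by simp [hD]
  have hDk2 : D (k + 1 + 1) = e ((k : ℤ) + 2) ^ 2 := by
    simp only [hD]; push_cast; ring_nf
  clear_value D
  -- values at the key
  have hl0 := hlip (-1)
  have hl1 := hlip 0
  norm_num at hl0 hl1
  have h01 : e 0 - e (-1) ≤ ρ := (abs_le.1 hl0).2
  have h10 : -ρ ≤ e 1 - e 0 := (abs_le.1 hl1).1
  have hk0' : 19 / 10 * ρ ≤ 2 * e 0 - e 1 - e (-1) := (le_div_iff₀ hρ).1 hk0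
  have hu_lo : 94 ≤ e 0 := by linarith only [hk0', h01, hE, hρ₁]
  have hu_hi : e 0 ≤ 141 := by linarith only [hup, hρ₂]
  have he1 := he 1
  have hδ0 : D 1 - D 0 ≤ -(9 / 10 * ρ * (e 0 + e 1)) := by
    rw [hD1, hD0]
    nlinarith only [mul_nonneg (by linarith only [hk0', h01] : 0 ≤ e 0 - e 1 - 9 / 10 * ρ) (by linarith only [he1, hu_lo] : 0 ≤ e 0 + e 1)]
  have hδ0' : D 1 - D 0 ≤ -(2 * ρ ^ 2) := by
    nlinarith only [hδ0, mul_nonneg hρ.le (by linarith only [he1, hu_lo, hE, hρ₂] : 0 ≤ 9 / 10 * (e 0 + e 1) - 2 * ρ)]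
  -- values at the second hole
  have hln := hlip ((k : ℤ) + 2)
  have hkn' : 1 * ρ ≤ 2 * e ((k + 2 : ℕ) : ℤ) - e ((k + 2 : ℕ) + 1) - e (((k + 2 : ℕ) : ℤ) - 1) := (le_div_iff₀ hρ).1 hkn
  have e4 : (((k + 2 : ℕ) : ℤ) - 1) = ((k + 1 : ℕ) : ℤ) := by push_cast; ring
  have e5 : (((k + 2 : ℕ) : ℤ) + 1) = (k : ℤ) + 2 + 1 := by push_cast; ring
  have e6 : (((k + 2 : ℕ) : ℤ)) = (k : ℤ) + 2 := by push_cast; ring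
  rw [e4] at hkn' hEn
  rw [e5, e6] at hkn'
  have hmono : e ((k + 1 : ℕ) : ℤ) ≤ e ((k : ℤ) + 2) := by
    have := (abs_le.1 hln).1
    linarith
  have hek1 := he ((k + 1 : ℕ) : ℤ)
  have hδn : -(2 * ρ ^ 2) < D (k + 1 + 1) - D (k + 1) := by
    rw [hDk2, hDk1]
    nlinarith only [mul_nonneg (sub_nonneg.2 hmono) (by linarith only [hek1, hmono] : 0 ≤ e ((k : ℤ) + 2) + e ((k + 1 : ℕ) : ℤ)), hρ]
  have hDn : (187 / 2 : ℝ) ^ 2 ≤ D (k + 1) := by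
    rw [hDk1]
    exact pow_le_pow_left₀ (by norm_num) hEn 2
  -- the turning index J
  have hex : ∃ j, -(2 * ρ ^ 2) < D (j + 1) - D j := ⟨k + 1, hδn⟩
  obtain ⟨J, hJ, hJmin, hJle⟩ : ∃ J, -(2 * ρ ^ 2) < D (J + 1) - D J ∧ (∀ j, j < J → D (j + 1) - D j ≤ -(2 * ρ ^ 2)) ∧
      J ≤ k + 1 :=
    ⟨Nat.find hex, Nat.find_spec hex, fun j hj => not_lt.1 (Nat.find_min hex hj), Nat.find_min' hex hδn⟩
  have hJpos : 1 ≤ J := by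
    by_contra h0
    have : J = 0 := by omega
    rw [this] at hJ
    linarith only [hJ, hδ0']
  obtain ⟨J', rfl⟩ : ∃ J', J = J' + 1 := ⟨J - 1, by omega⟩
  have hδJ0 : D (J' + 1 + 1) - D (J' + 1) ≤ 0 := by
    have h1 := hstep' J'
    have h2 := hJmin J' (by omega)
    linarith only [h1, h2]
  -- descent, bounce, iteration, ascent
  have hρ2 : 0 < ρ ^ 2 := by positivity
  have c1 := fc_descent D (ρ ^ 2) hstep (J' + 1) hJmin
  have c4 : (D (J' + 1 + 1) - D (J' + 1)) ^ 2 ≤ 4 * (ρ ^ 2) ^ 2 := by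
    nlinarith only [mul_nonneg (by linarith only [hJ] : 0 ≤ D (J' + 1 + 1) - D (J' + 1) + 2 * ρ ^ 2)
      (by linarith only [hδJ0, hρ2] : 0 ≤ 2 * ρ ^ 2 - (D (J' + 1 + 1) - D (J' + 1)))]
  have c6 : D (J' + 1 + 1) - D (J' + 1) ≤ (D 1 - D 0) + 2 * ρ ^ 2 * ((J' + 1 : ℕ) : ℝ) := by
    have := fc_iter_le (fun j => D (j + 1) - D j) (2 * ρ ^ 2) hstep' 0 (J' + 1)
    simpa using this
  obtain ⟨i, hi⟩ : ∃ i, J' + 1 + i = k + 1 := ⟨k - J', by omega⟩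
  have c5 : D (J' + 1 + i) ≤ D (J' + 1) + ρ ^ 2 * (i : ℝ) ^ 2 := by
    refine fc_ascent D (by positivity) (J' + 1) (fun i' => ?_) i
    have := fc_iter_le (fun j => D (j + 1) - D j) (2 * ρ ^ 2) hstep' (J' + 1) i'
    linarith only [this, hδJ0]
  rw [hi] at c5
  -- real-number endgame
  have hJi : ((J' + 1 : ℕ) : ℝ) + i = k + 1 := by exact_mod_cast hi
  have hir : (0 : ℝ) ≤ i := Nat.cast_nonneg i
  have hk2 : ((k + 2 : ℕ) : ℝ) = (k : ℝ) + 2 := by push_cast; ring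
  rw [hk2] at hwin
  have hwin' : (((J' + 1 : ℕ) : ℝ) + i) * ρ ≤ 160 + ρ := by
    rw [hJi]; linarith only [hwin]
  have hJr0 : 9 / 10 * ρ * (e 0 + e 1) ≤ 2 * ρ ^ 2 * ((J' + 1 : ℕ) : ℝ) + 2 * ρ ^ 2 := by linarith only [c6, hJ, hδ0]
  have hJr : 9 / 20 * (e 0 + e 1) - ρ ≤ ρ * ((J' + 1 : ℕ) : ℝ) := by
    refine le_of_mul_le_mul_left ?_ hρ
    linarith only [hJr0]
  have ht0 : 0 ≤ ρ * i := by positivity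
  have htB : ρ * i ≤ 160 + 2 * ρ - 9 / 20 * (e 0 + e 1) := by linarith only [hwin', hJr]
  have htB2 : (ρ * i) ^ 2 ≤ (160 + 2 * ρ - 9 / 20 * (e 0 + e 1)) ^ 2 := pow_le_pow_left₀ ht0 htB 2
  have hδ0sq : (9 / 10 * ρ * (e 0 + e 1)) ^ 2 ≤ (D 1 - D 0) ^ 2 := by
    have hnn : 0 ≤ 9 / 10 * ρ * (e 0 + e 1) := by positivity
    have h' : 9 / 10 * ρ * (e 0 + e 1) ≤ -(D 1 - D 0) := by linarith only [hδ0]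
    have h'' := pow_le_pow_left₀ hnn h' 2
    simpa only [neg_sq] using h''
  -- chain: 4ρ²·93.5² ≤ 4ρ² D(k+1) ≤ 4ρ² D_J + 4ρ² (ρ i)² ≤ 4ρ² e0² − δ0² − 4ρ³ (ρ J) + 4ρ⁴ + 4ρ² (ρ i)²
  have a1 : 4 * ρ ^ 2 * (187 / 2 : ℝ) ^ 2 ≤ 4 * ρ ^ 2 * D (k + 1) := mul_le_mul_of_nonneg_left hDn (by positivity)
  have a2 : 4 * ρ ^ 2 * D (k + 1) ≤ 4 * ρ ^ 2 * (D (J' + 1) + ρ ^ 2 * (i : ℝ) ^ 2) := mul_le_mul_of_nonneg_left c5 (by positivity)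
  have key1 : 4 * ρ ^ 2 * (187 / 2 : ℝ) ^ 2 ≤
      4 * ρ ^ 2 * e 0 ^ 2 - (9 / 10 * ρ * (e 0 + e 1)) ^ 2 - 4 * ρ ^ 3 * (ρ * ((J' + 1 : ℕ) : ℝ)) + 4 * (ρ ^ 2) ^ 2 +
        4 * ρ ^ 2 * (ρ * i) ^ 2 := by
    rw [hD0] at c1 hδ0sq
    linarith only [a1, a2, c1, c4, hδ0sq]
  have p1 : 4 * ρ ^ 2 * (ρ * (9 / 20 * (e 0 + e 1) - ρ)) ≤ 4 * ρ ^ 2 * (ρ * (ρ * ((J' + 1 : ℕ) : ℝ))) :=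
    mul_le_mul_of_nonneg_left (mul_le_mul_of_nonneg_left hJr hρ.le) (by positivity)
  have p2 : 4 * ρ ^ 2 * (ρ * i) ^ 2 ≤ 4 * ρ ^ 2 * (160 + 2 * ρ - 9 / 20 * (e 0 + e 1)) ^ 2 :=
    mul_le_mul_of_nonneg_left htB2 (by positivity)
  have b1 : ρ ^ 2 * (4 * (187 / 2 : ℝ) ^ 2) ≤
      ρ ^ 2 * (4 * e 0 ^ 2 - (9 / 10 * (e 0 + e 1)) ^ 2 - 4 * ρ * (9 / 20 * (e 0 + e 1) - ρ) + 4 * ρ ^ 2 +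
        4 * (160 + 2 * ρ - 9 / 20 * (e 0 + e 1)) ^ 2) := by
    nlinarith only [key1, p1, p2]
  have key2 := le_of_mul_le_mul_left b1 hρ2
  nlinarith only [key2, mul_nonneg (sub_nonneg.2 hu_lo) (sub_nonneg.2 hu_hi), mul_nonneg (sub_nonneg.2 hu_lo) (sub_nonneg.2 hρ₁),
    mul_nonneg hρ.le (sub_nonneg.2 hρ₂), mul_nonneg (by linarith only [h10] : 0 ≤ e 1 - e 0 + ρ) (by linarith only [hρ₁] : (0 : ℝ) ≤ 576 + 9 * ρ),
    hρ₁, hρ₂, hu_lo, hu_hi, h10]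

/-- ★★ **NO SECOND HOLE**: in a marked fibre at `R_N = 80`, `ρ ∈ [0.679, 0.691]` whose key has kink `≥ 1.9` (column `≥ 11`), the key is the ONLY
marked position.  (Reduction to the normalised core by translation `t ↦ t₀ + u` or reflection `t ↦ t₀ − u`; parity makes the gap `≥ 2`.) -/
theorem fc_eq_key_of_kink {ρ : ℝ} (hρ₁ : 679 / 1000 ≤ ρ) (hρ₂ : ρ ≤ 691 / 1000) {e m : ℤ → ℝ} {S : Finset ℤ} {t₀ : ℤ}
    (hF : IsMarkedFibre 80 ρ e m S t₀) (h19 : 19 / 10 ≤ kink1 ρ e t₀) {t : ℤ} (ht : t ∈ S) : t = t₀ := by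
  obtain ⟨he, hlip, hsc, hm, hpair, htab, ht₀, -⟩ := hF
  by_contra hne
  obtain ⟨hev, hwin⟩ := hpair t ht t₀ ht₀
  obtain ⟨hr0, -, hup0⟩ := htab t₀ ht₀
  obtain ⟨hrt, hct, -⟩ := htab t ht
  have hm0 := fc_le_of_capKRow _ hr0
  have hmt := fc_le_of_capKRow _ hrt
  have hkt := fc_le_of_capKCol_two _ hct
  obtain ⟨hm0a, hm0b, hm0c⟩ := hm t₀
  obtain ⟨-, hmtb, hmtc⟩ := hm t
  unfold kink1 at h19 hkt
  rcases lt_or_gt_of_ne hne with hlt | hgt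
  · -- `t < t₀`: reflect about the key
    have h2 : 2 ≤ t₀ - t := by obtain ⟨r, hr⟩ := hev; omega
    obtain ⟨n, hn⟩ : ∃ n : ℕ, (n : ℤ) = t₀ - t := ⟨(t₀ - t).toNat, Int.toNat_of_nonneg (by omega)⟩
    have hnR : (n : ℝ) = (t₀ : ℝ) - t := by exact_mod_cast hn
    refine fc_noSecondHole_core hρ₁ hρ₂ (fun u => e (t₀ - u)) n (by omega) (fun u => he _) (fun u => ?_) (fun u => ?_) ?_ ?_ ?_
      ?_ ?_ ?_
    · have h := hlip (t₀ - (u + 1))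
      rw [show t₀ - (u + 1) + 1 = t₀ - u by ring] at h
      rwa [abs_sub_comm] at h
    · have h := hsc (t₀ - u)
      rw [show t₀ - u + 1 = t₀ - (u - 1) by ring, show t₀ - u - 1 = t₀ - (u + 1) by ring] at h
      linarith
    · show 19 / 10 ≤ (2 * e (t₀ - 0) - e (t₀ - 1) - e (t₀ - -1)) / ρ
      rw [sub_zero, sub_neg_eq_add, show 2 * e t₀ - e (t₀ - 1) - e (t₀ + 1) = 2 * e t₀ - e (t₀ + 1) - e (t₀ - 1) by ring]
      exact h19
    · show 187 / 2 ≤ e (t₀ - 1)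
      linarith
    · show e (t₀ - 0) < 140 + ρ
      rw [sub_zero]; linarith
    · show 1 ≤ (2 * e (t₀ - (n : ℤ)) - e (t₀ - ((n : ℤ) + 1)) - e (t₀ - ((n : ℤ) - 1))) / ρ
      rw [hn, show t₀ - (t₀ - t) = t by ring, show t₀ - (t₀ - t + 1) = t - 1 by ring, show t₀ - (t₀ - t - 1) = t + 1 by ring,
        show 2 * e t - e (t - 1) - e (t + 1) = 2 * e t - e (t + 1) - e (t - 1) by ring]
      exact hkt
    · show 187 / 2 ≤ e (t₀ - ((n : ℤ) - 1))
      rw [hn, show t₀ - (t₀ - t - 1) = t + 1 by ring]; linarith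
    · rw [hnR]
      rw [abs_sub_comm] at hwin
      rwa [abs_of_nonneg (by rw [sub_nonneg]; exact_mod_cast hlt.le)] at hwin
  · -- `t₀ < t`: translate to the key
    have h2 : 2 ≤ t - t₀ := by obtain ⟨r, hr⟩ := hev; omega
    obtain ⟨n, hn⟩ : ∃ n : ℕ, (n : ℤ) = t - t₀ := ⟨(t - t₀).toNat, Int.toNat_of_nonneg (by omega)⟩
    have hnR : (n : ℝ) = (t : ℝ) - t₀ := by exact_mod_cast hn
    refine fc_noSecondHole_core hρ₁ hρ₂ (fun u => e (t₀ + u)) n (by omega) (fun u => he _) (fun u => ?_) (fun u => ?_) ?_ ?_ ?_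
      ?_ ?_ ?_
    · have h := hlip (t₀ + u)
      rwa [show t₀ + u + 1 = t₀ + (u + 1) by ring] at h
    · have h := hsc (t₀ + u)
      rw [show t₀ + u + 1 = t₀ + (u + 1) by ring, show t₀ + u - 1 = t₀ + (u - 1) by ring] at h
      exact h
    · show 19 / 10 ≤ (2 * e (t₀ + 0) - e (t₀ + 1) - e (t₀ + -1)) / ρ
      rw [add_zero, ← sub_eq_add_neg]
      exact h19
    · show 187 / 2 ≤ e (t₀ + 1)
      linarith
    · show e (t₀ + 0) < 140 + ρ
      rw [add_zero]; linarith
    · show 1 ≤ (2 * e (t₀ + (n : ℤ)) - e (t₀ + ((n : ℤ) + 1)) - e (t₀ + ((n : ℤ) - 1))) / ρ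
      rw [hn, show t₀ + (t - t₀) = t by ring, show t₀ + (t - t₀ + 1) = t + 1 by ring, show t₀ + (t - t₀ - 1) = t - 1 by ring]
      exact hkt
    · show 187 / 2 ≤ e (t₀ + ((n : ℤ) - 1))
      rw [hn, show t₀ + (t - t₀ - 1) = t - 1 by ring]; linarith
    · rw [hnR]
      rwa [abs_of_nonneg (by rw [sub_nonneg]; exact_mod_cast hgt.le)] at hwin

end NoSecondHole

/-! ## §B3 (F) ⟸ (F_lo): the key columns `11, 12` are PROVED (line excess `0`, the key alone) -/

section HighColumns

/-- ★★ **(F) ⟸ (F_lo)** at `R_N = 80`, `[ρlo, ρhi] = [0.679, 0.691]`: for a key of column `≥ 11` the fibre carries no other marked position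
(`fc_eq_key_of_kink`), so the sum is the key's own charge and the excess `E ≥ 0` is not needed; the columns `≤ 10` are (F_lo). -/
theorem fibreChargeQ_of_low (h : FibreChargeLowQ 80 (679 / 1000) (691 / 1000)) : FibreChargeQ 80 (679 / 1000) (691 / 1000) := by
  intro ρ hρ₁ hρ₂ e m S t₀ hF
  by_cases hcol : capKCol (kink1 ρ e t₀) ≤ 10
  · exact h ρ hρ₁ hρ₂ e m S t₀ hF hcol
  · have h19 : 19 / 10 ≤ kink1 ρ e t₀ := fc_le_of_capKCol_eleven _ (by omega)
    have hS : S = {t₀} := by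
      ext t
      simp only [Finset.mem_singleton]
      constructor
      · intro ht; exact fc_eq_key_of_kink hρ₁ hρ₂ hF h19 ht
      · rintro rfl; exact hF.2.2.2.2.2.2.1
    rw [hS, Finset.sum_singleton]
    linarith [lineExcess_nonneg (capKCol (kink1 ρ e t₀)) ({t₀} : Finset ℤ).card]

end HighColumns

end Summit.AtomisticToContinuum.Crystallization.Theorems.ChargedEnergyGapChartDial
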